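import Literature.MathematicalPhysics.QuantumFieldTheory.Balaban1983to89.T4ObservableTelescope
import Literature.MathematicalPhysics.QuantumFieldTheory.Balaban1983to89.T4TiltModulusRelative

/-!
# `Balaban1983to89.T4CondMeanChannel` — the FIRST-ORDER (conditional-mean) CHANNEL of one ℝ-increment, BY NAME:
# pv16's `CondMeanSuppression` suppliers ⇒ the channel `hp` of `T4ObservableTelescope.condMeanDev_of_channels` ⇒
# `CondMeanDev` ⇒ `CondMeanGap` ⇒ `|termDefect| ≤ ε·mass` (cell T4, node O3b/H2 = NE1′, row O3.E-i′ (β); bookkeeping seam)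

HONEST FRAMING.  Audit cell `pub-balaban`, unit `b2b-balaban-pv16-g11` (SURGE NODE PROVER #16, journal row
`T4-O3.E-i′-β-CMCHANNEL*`, self-proposed under the yield clause of T4-DAG v15 row O3.E-i′ (β); companion record
`HOME/t4/T4-EST-O3Ei1.md`).  The cell's T4 target is the existence and uniqueness of the continuum limit of unit-scale averaged
loop expectations on a FINITE torus, with Bałaban's densities as GIVEN data satisfying the printed end statement (B) as a
HYPOTHESIS; it is NOT an infinite-volume statement, NOT a mass gap, NOT the Clay problem, and this module is NOT progress on
any summit.  Value = a kernel-checked SEAM between two lineages of the cell's bookkeeping and nothing more: the unit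
`b2b-balaban-t4-ne1p-p3` located the ONE inequality its observable-level telescoping needs per ℝ-increment as the hypothesis
shape `T4ObservableTelescope.CondMeanGap` and split a one-law deviation `CondMeanDev` into a FIRST-ORDER channel `hp` (the
conditional mean of a «linear part» `ℓ`) and a second-order channel `hq` (`condMeanDev_of_channels`, its GAPS G-ne1p3-1
«law-(I) half: rows O3.E-i′»); the pv16 lineage typed the first-order size mechanism `T4FirstOrderSize.CondMeanSuppression`
and its suppliers from the tilt modulus (`T4TiltModulus.condMeanSuppression_of_tilt`, `T4TiltModulusRelative.
condMeanSuppression_of_relTilt`, `T4FirstOrderSize.condMeanSuppression_of_flat`).  This module proves that the latter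
DISCHARGE the former's channel `hp` when the linear part is the linear density of a bond-insert field, and assembles the
increment bound end to end.  NO size of any deviation, Lipschitz constant, oscillation or remainder for Bałaban's actual
densities is asserted or proved here (GAPS G-ne1p3-1 / G-ne1p3-2 stay OPEN; the LIP MATCH questions (hlip)/(hdev) of
record `T4-EST-O3Ei1.md` §4e are other rows' business).

CITATION HEADER.  What is taken from T. Bałaban's series (CMP 1984–89) is ONLY what the imported tree modules already quote
and model, re-used BY NAME: the concrete shape of one term of the large-field operation [Balaban1989LargeFieldI] (0.3)
p. 176 / (1.100)–(1.102) p. 201 as modelled by `B15.BasicStep.normTerm` / `fibreIntegral` with the proviso «the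
denominators are positive» (`T4ObservableTelescope.TermProvisos.den_ne`); the conditional fibre law and conditional mean
`T4DressingDefect.condLaw` / `condMean`; the linear part `t·Σ_{b∈S}⟪a b, B b⟫` of an exponent term charged to
[Balaban1988RG2Cluster] (2.20) p. 16 as typed by `T4FirstOrderSize.linTerm`; the relative fibre variable «V = V′V^{(k)}»
[Balaban1987RG1] p. 265 as typed by `T4CondLawRelative.relDensity` / `T4TiltModulusRelative.relInsert`.  No page of the
series was newly read for this module; no sentence is newly attributed to it; nothing of Bałaban's averaging, of his
small-field densities, of his minimisers or of his R beyond the cited tree shapes is encoded (cell DIVERGENCE F6/F9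
honoured).  ABSOLUTE RULE honoured: no programme-internal statement is a hypothesis-free input — every size below enters as a
binder (`CondMeanSuppression`, a domain cover `hdom`, a deviation cap `hdev`, a remainder bound `hq`); every declaration is
[folklore] bookkeeping.

WHAT IS PROVED (all [folklore]; no `sorry`, no new axiom):
§1 OBJECTS.  For a bond-insert field `Φ : GaugeField → β → E` (`E` a real inner product space, `β` an index of bonds) the
   LINEAR DENSITY `linDensity t S a Φ : Density := U ↦ linTerm t S a (Φ U)` and the CONDITIONAL MEAN FIELD
   `condMeanField s w Φ V : β → E := b ↦ ∫ Φ(V←y) b d(condLaw s w V)(y)` (= `T4FirstOrderSize.meanField (condLaw s w V)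
   (y ↦ Φ(V←y))` by `rfl`); measurability and the sup bound of the linear density (`measurable_linDensity`,
   `abs_linDensity_le`); `onFibre s (V←y) = y`.
§2 THE CHANNEL.  (A1) `condMean s w (linDensity t S a Φ) V = linTerm t S a (condMeanField s w Φ V)` — the conditional mean
   of the linear density IS the linear part at the conditional mean field (`condMean_linDensity`, from
   `T4FirstOrderSize.integral_linTerm`; integrability from strong measurability + a bound, the conditional law being zero or
   a probability measure).  (A2) `CondMeanSuppression dom (condMeanField s w Φ) S dev lip` gives, at every exterior
   `V ∈ dom`, `|condMean s w (linDensity t S a Φ) V| ≤ |t|·(|S|·A·(lip·dev V))` for per-bond amplitudes `‖a b‖ ≤ A`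
   (`abs_condMean_linDensity_le`, = `T4FirstOrderSize.abs_linTerm_mean_le`); with a cover of the live fibres
   `fibreIntegral s w V ≠ 0 → V ∈ dom`, a cap `dev ≤ dev₀` on `dom` and `0 ≤ lip` this is EXACTLY the hypothesis `hp` of
   `T4ObservableTelescope.condMeanDev_of_channels` with `p = |t|·(|S|·A·(lip·dev₀))` (`condMean_channel_of_suppression`).
§3 ASSEMBLY.  (B1) `condMeanDev_of_suppression`: `CondMeanDev s w g m (p + q)` BY NAME through `condMeanDev_of_channels`
   with the first-order channel discharged by (A2) and the second-order channel `hq` kept as a binder.  (B2) the pointwise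
   form of the channel split (`abs_condMean_sub_le_of_channels_at`, the proof of `condMeanDev_of_channels` at one exterior
   field) and the two-law gap with the insert side LOCALISED to the live set of the integrated density
   (`condMeanGap_of_dev_at`) — needed because the printed proviso makes EVERY exterior live for the insert, so the global
   `CondMeanDev s ins …` of `condMeanGap_of_dev` would ask the insert-side domain to be everything.  (B3)
   `abs_termDefect_le_of_suppression`: under `TermProvisos`, suppression data for the old term's fibre law AND for the
   insert's, both domains covering the old term's live exteriors, `|termDefect s ins old g| ≤ ((p₁+q₁)+(p₂+q₂))·∫dV old` by
   `T4ObservableTelescope.abs_termDefect_le_of_condMeanGap`.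
§4 INSTANCES BY NAME from the pv16 suppliers.  For the RAW fibre reading `fibreReading s B : U ↦ B(U⌈_s)` of bond inserts
   `B : (s → G) → β → E` the conditional mean field IS the exterior-indexed mean field of `T4TiltModulus` §3
   (`condMeanField_fibreReading`), so `condMeanSuppression_of_tilt` discharges the channel on the tilt domain with
   `p = |t|·(|S|·A·(2e^{2ε₀}M·ε₀))` (`condMean_channel_of_tilt`: the cap `ε ≤ ε₀` is part of `tiltDom`); for the RELATIVE
   reading `relReading s vΛ B : U ↦ B(U⌈_s·(vΛ U)⌈_s⁻¹)` under `FieldIndep s vΛ` the conditional mean field is that of the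
   relative inserts (`condMeanField_relReading`), so `condMeanSuppression_of_relTilt` discharges it on the relative tilt
   domain with the same `p` (`condMean_channel_of_relTilt`).  Any other `CondMeanSuppression` (e.g. from
   `condMeanSuppression_of_flat` with a `MeanLipschitz` binder of another origin) feeds `condMean_channel_of_suppression`
   directly.

HONEST SCOPE / NOT PROVED.  (i) The sizes: `dev₀` (for the tilt suppliers `= ε₀`, the oscillation cap of the tilt — its
value for Bałaban's densities is the (LOG)/(LOG-SIZE) input of the pv28 lineage, row `T4-O3.E-iii-b-G7-LOGSIZE*`), `lip`,
`M`, the amplitude `A` and weight `t` of the linearised dressing, the remainder sizes `q` (second-order channel, rows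
O3.E-iii) — all binders.  (ii) The domain cover `hdom` («wherever the term has mass its exterior lies in the analyticity /
tilt domain») is the typed form of the characteristic functions carried by Bałaban's densities; nothing about them is
asserted.  (iii) `MeanVanishes` at the reference exterior (row O3.E-i′ (α)/K) is a binder of the §4 instances.  (iv) No
K-uniform summation is done here (that is `T4ObservableTelescope` §2 with sizes from U5/U6).  (v) Complex loop parameters,
the (2.18) format and the two-run matching are outside this module.
-/

noncomputable section

open _root_.MeasureTheory
open Function (updateFinset)
open scoped BigOperators InnerProductSpace ENNReal

namespace Literature.MathematicalPhysics.QuantumFieldTheory.Balaban1983to89.T4CondMeanChannel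

open B15.BasicStep T4DressedR T4DressingDefect T4FirstOrderSize T4FibreTranslate T4CondLawRelative T4TiltModulus
  T4TiltModulusRelative T4ObservableTelescope

section Fibre

variable {P : Params} {j : ℕ} {G : Type*} [GaugeGroup G] [MeasurableSpace G] [HaarData G]
variable [DecidableEq (PBond P j)]
variable {β : Type*} {E : Type*} [NormedAddCommGroup E] [InnerProductSpace ℝ E]

/-! ## §1  The linear density of a bond-insert field and its conditional mean field -/

omit [MeasurableSpace G] [HaarData G] [DecidableEq (PBond P j)] in
/-- THE LINEAR DENSITY of a bond-insert field `Φ : GaugeField → β → E` with scalar weight `t`, bond set `S` and coefficient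
field `a`: `U ↦ t·Σ_{b∈S}⟪a b, Φ U b⟫` — the «linear part» `ℓ` of the first-order channel of
`T4ObservableTelescope.condMeanDev_of_channels`, in the format of `T4FirstOrderSize.linTerm`. [folklore] -/
def linDensity (t : ℝ) (S : Finset β) (a : β → E) (Φ : GaugeField P j G → β → E) : Density P j G :=
  fun U => linTerm t S a (Φ U)

omit [GaugeGroup G] [MeasurableSpace G] [HaarData G] [DecidableEq (PBond P j)] in
/-- Unfolding lemma. [folklore] -/
theorem linDensity_apply (t : ℝ) (S : Finset β) (a : β → E) (Φ : GaugeField P j G → β → E) (U : GaugeField P j G) :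
    linDensity t S a Φ U = linTerm t S a (Φ U) := rfl

/-- THE CONDITIONAL MEAN FIELD of the bond-insert field `Φ` under the conditional fibre law of `w` through `V`:
`b ↦ E^{w}_s[Φ(·) b | V_out] = ∫ Φ(V←y) b d(condLaw s w V)(y)` (Bochner integral; `= 0` in the degenerate case).
[folklore] -/
def condMeanField (s : Finset (PBond P j)) (w : Density P j G) (Φ : GaugeField P j G → β → E) (V : GaugeField P j G) :
    β → E :=
  fun b => ∫ y, Φ (updateFinset V s y) b ∂condLaw s w V

/-- The conditional mean field IS pv16's `meanField` of the pulled-back insert under the conditional law (`rfl`).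
[folklore] -/
theorem condMeanField_eq_meanField (s : Finset (PBond P j)) (w : Density P j G) (Φ : GaugeField P j G → β → E)
    (V : GaugeField P j G) :
    condMeanField s w Φ V = meanField (condLaw s w V) (fun y => Φ (updateFinset V s y)) := rfl

omit [GaugeGroup G] [HaarData G] [DecidableEq (PBond P j)] in
/-- Restriction to the fibre index type is measurable (product σ-algebra). [folklore] -/
theorem measurable_onFibre (s : Finset (PBond P j)) : Measurable (onFibre s : GaugeField P j G → s → G) :=
  measurable_pi_lambda _ fun b => measurable_pi_apply (b : PBond P j)

omit [GaugeGroup G] [MeasurableSpace G] [HaarData G] in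
/-- `(V←y)⌈_s = y`: restricting an updated field to the fibre returns the fibre configuration. [folklore] -/
theorem onFibre_updateFinset (s : Finset (PBond P j)) (V : GaugeField P j G) (y : s → G) :
    onFibre s (updateFinset V s y) = y := by
  funext b
  simp only [onFibre, updateFinset, dif_pos b.2]

omit [GaugeGroup G] [HaarData G] [DecidableEq (PBond P j)] in
/-- The linear density of a bondwise strongly measurable insert field is measurable. [folklore] -/
theorem measurable_linDensity (t : ℝ) {S : Finset β} (a : β → E) {Φ : GaugeField P j G → β → E}
    (hΦ : ∀ b ∈ S, StronglyMeasurable fun U => Φ U b) : Measurable (linDensity t S a Φ) := by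
  unfold linDensity linTerm
  exact measurable_const.mul
    (Finset.measurable_sum S fun b hb => (stronglyMeasurable_const.inner (hΦ b hb)).measurable)

omit [GaugeGroup G] [MeasurableSpace G] [HaarData G] [DecidableEq (PBond P j)] in
/-- The sup bound of the linear density: `|linDensity t S a Φ U| ≤ |t|·(|S|·A·R)` for `‖a b‖ ≤ A`, `‖Φ U b‖ ≤ R` on `S`
(`T4FirstOrderSize.abs_linTerm_le_sup`). [folklore] -/
theorem abs_linDensity_le {t : ℝ} {S : Finset β} {a : β → E} {Φ : GaugeField P j G → β → E} {A R : ℝ}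
    (hA : ∀ b ∈ S, ‖a b‖ ≤ A) (hR : ∀ b ∈ S, ∀ U, ‖Φ U b‖ ≤ R) (U : GaugeField P j G) :
    |linDensity t S a Φ U| ≤ |t| * ((S.card : ℝ) * A * R) :=
  abs_linTerm_le_sup hA (fun b hb => hR b hb U) t

omit [InnerProductSpace ℝ E] in
/-- `|S|·A ≥ 0` from per-bond amplitude bounds (trivially when `S = ∅`). [folklore] -/
theorem card_mul_nonneg_of_amplitude {S : Finset β} {a : β → E} {A : ℝ} (hA : ∀ b ∈ S, ‖a b‖ ≤ A) :
    0 ≤ (S.card : ℝ) * A := by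
  rcases S.eq_empty_or_nonempty with hS | ⟨b, hb⟩
  · rw [hS, Finset.card_empty, Nat.cast_zero, zero_mul]
  · exact mul_nonneg (Nat.cast_nonneg _) ((norm_nonneg _).trans (hA b hb))

/-! ## §2  The first-order channel: conditional mean of the linear density under `CondMeanSuppression` -/

/-- **(A1) THE CONDITIONAL MEAN OF THE LINEAR DENSITY IS THE LINEAR PART AT THE CONDITIONAL MEAN FIELD**:
`condMean s w (linDensity t S a Φ) V = linTerm t S a (condMeanField s w Φ V)` — `T4FirstOrderSize.integral_linTerm` for
the conditional law (zero or a probability measure for `w ≤ C`), the integrability of each pulled-back bond insert coming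
from strong measurability and a bound. [folklore] -/
theorem condMean_linDensity [CompleteSpace E] (s : Finset (PBond P j)) {w : Density P j G} {C : ℝ} (hC : ∀ U, w U ≤ C)
    (t : ℝ) {S : Finset β} (a : β → E) {Φ : GaugeField P j G → β → E}
    (hΦ : ∀ b ∈ S, StronglyMeasurable fun U => Φ U b) {R : ℝ} (hR : ∀ b ∈ S, ∀ U, ‖Φ U b‖ ≤ R)
    (V : GaugeField P j G) :
    condMean s w (linDensity t S a Φ) V = linTerm t S a (condMeanField s w Φ V) := by
  haveI := isZeroOrProbabilityMeasure_condLaw s hC V (old := w)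
  exact integral_linTerm (condLaw s w V) t S a (fun y => Φ (updateFinset V s y)) fun b hb =>
    Integrable.of_bound ((hΦ b hb).comp_measurable measurable_updateFinset).aestronglyMeasurable R
      (Filter.Eventually.of_forall fun y => hR b hb _)

/-- **(A2) THE CHANNEL AT ONE EXTERIOR FIELD**: under `CondMeanSuppression dom (condMeanField s w Φ) S dev lip`, at
`V ∈ dom`, `|condMean s w (linDensity t S a Φ) V| ≤ |t|·(|S|·A·(lip·dev V))` for per-bond amplitudes `‖a b‖ ≤ A`
(`T4FirstOrderSize.abs_linTerm_mean_le` after (A1)). [folklore] -/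
theorem abs_condMean_linDensity_le [CompleteSpace E] (s : Finset (PBond P j)) {w : Density P j G} {C : ℝ}
    (hC : ∀ U, w U ≤ C) (t : ℝ) {S : Finset β} {a : β → E} {A : ℝ} (hA : ∀ b ∈ S, ‖a b‖ ≤ A)
    {Φ : GaugeField P j G → β → E} (hΦ : ∀ b ∈ S, StronglyMeasurable fun U => Φ U b) {R : ℝ}
    (hR : ∀ b ∈ S, ∀ U, ‖Φ U b‖ ≤ R) {dom : Set (GaugeField P j G)} {dev : GaugeField P j G → ℝ} {lip : ℝ}
    (hsup : CondMeanSuppression dom (condMeanField s w Φ) S dev lip) {V : GaugeField P j G} (hV : V ∈ dom) :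
    |condMean s w (linDensity t S a Φ) V| ≤ |t| * ((S.card : ℝ) * A * (lip * dev V)) := by
  rw [condMean_linDensity s hC t a hΦ hR V]
  exact abs_linTerm_mean_le hsup hV hA t

/-- **(A2′) THE CHANNEL `hp` OF `T4ObservableTelescope.condMeanDev_of_channels`, DISCHARGED**: if the suppression domain
covers the live fibres of `w` (`fibreIntegral s w V ≠ 0 → V ∈ dom` — the typed «support ⊆ analyticity domain»), the
deviation is capped by `dev₀` on the domain and `0 ≤ lip`, then
`∀ V, fibreIntegral s w V ≠ 0 → |condMean s w (linDensity t S a Φ) V| ≤ |t|·(|S|·A·(lip·dev₀))`. [folklore] -/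
theorem condMean_channel_of_suppression [CompleteSpace E] (s : Finset (PBond P j)) {w : Density P j G} {C : ℝ}
    (hC : ∀ U, w U ≤ C) (t : ℝ) {S : Finset β} {a : β → E} {A : ℝ} (hA : ∀ b ∈ S, ‖a b‖ ≤ A)
    {Φ : GaugeField P j G → β → E} (hΦ : ∀ b ∈ S, StronglyMeasurable fun U => Φ U b) {R : ℝ}
    (hR : ∀ b ∈ S, ∀ U, ‖Φ U b‖ ≤ R) {dom : Set (GaugeField P j G)} {dev : GaugeField P j G → ℝ} {lip : ℝ}
    (hsup : CondMeanSuppression dom (condMeanField s w Φ) S dev lip) (hdom : ∀ V, fibreIntegral s w V ≠ 0 → V ∈ dom)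
    {dev₀ : ℝ} (hdev : ∀ V ∈ dom, dev V ≤ dev₀) (hlip : 0 ≤ lip) :
    ∀ V, fibreIntegral s w V ≠ 0 → |condMean s w (linDensity t S a Φ) V| ≤ |t| * ((S.card : ℝ) * A * (lip * dev₀)) := by
  intro V hne
  refine (abs_condMean_linDensity_le s hC t hA hΦ hR hsup (hdom V hne)).trans ?_
  exact mul_le_mul_of_nonneg_left
    (mul_le_mul_of_nonneg_left (mul_le_mul_of_nonneg_left (hdev V (hdom V hne)) hlip)
      (card_mul_nonneg_of_amplitude hA)) (abs_nonneg t)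

/-! ## §3  Assembly: one-law deviation, the localised two-law gap, the increment bound -/

/-- **(B1) ONE-LAW DEVIATION WITH THE FIRST-ORDER CHANNEL DISCHARGED BY SUPPRESSION** — BY NAME through
`T4ObservableTelescope.condMeanDev_of_channels`: for a law `w` (measurable, `≤ C`), a weight `g`, a fibre-independent
reference functional `m`, the linear density of `Φ` as the linear part, suppression data covering the live fibres, and the
second-order channel `hq` as a binder: `CondMeanDev s w g m (|t|·(|S|·A·(lip·dev₀)) + q)`. [folklore] -/
theorem condMeanDev_of_suppression [CompleteSpace E] (s : Finset (PBond P j)) {w : Density P j G} (hm : Measurable w)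
    {C : ℝ} (hC : ∀ U, w U ≤ C) {g m : Density P j G} (hg : Measurable g) (hmm : Measurable m) {Bg Bm : ℝ}
    (hBg : ∀ U, |g U| ≤ Bg) (hBm : ∀ U, |m U| ≤ Bm) (hmI : FibreIndep s m) (t : ℝ) {S : Finset β} {a : β → E}
    {A : ℝ} (hA : ∀ b ∈ S, ‖a b‖ ≤ A) {Φ : GaugeField P j G → β → E}
    (hΦ : ∀ b ∈ S, StronglyMeasurable fun U => Φ U b) {R : ℝ} (hR : ∀ b ∈ S, ∀ U, ‖Φ U b‖ ≤ R)
    {dom : Set (GaugeField P j G)} {dev : GaugeField P j G → ℝ} {lip : ℝ}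
    (hsup : CondMeanSuppression dom (condMeanField s w Φ) S dev lip) (hdom : ∀ V, fibreIntegral s w V ≠ 0 → V ∈ dom)
    {dev₀ : ℝ} (hdev : ∀ V ∈ dom, dev V ≤ dev₀) (hlip : 0 ≤ lip) {q : ℝ}
    (hq : ∀ (V : GaugeField P j G) (y : s → G), w (updateFinset V s y) ≠ 0 →
      |g (updateFinset V s y) - m V - linDensity t S a Φ (updateFinset V s y)| ≤ q) :
    CondMeanDev s w g m (|t| * ((S.card : ℝ) * A * (lip * dev₀)) + q) :=
  condMeanDev_of_channels s hm hC hg hmm (measurable_linDensity t a hΦ) hBg hBm (abs_linDensity_le hA hR) hmI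
    (condMean_channel_of_suppression s hC t hA hΦ hR hsup hdom hdev hlip) hq

/-- **(B2) THE CHANNEL SPLIT AT ONE EXTERIOR FIELD** — the proof of `T4ObservableTelescope.condMeanDev_of_channels` at a
single `V` with non-vanishing fibre integral: `|E^{w}_s[g | V_out] − m V| ≤ p + q` from `|E^{w}_s[ℓ | V_out]| ≤ p` and the
remainder bound `|g(V←y) − m V − ℓ(V←y)| ≤ q` on the support of `w(V←·)`.  Needed for the INSERT side of the two-law gap,
whose printed proviso makes every exterior live. [folklore] -/
theorem abs_condMean_sub_le_of_channels_at (s : Finset (PBond P j)) {w : Density P j G} (hm : Measurable w) {C : ℝ}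
    (hC : ∀ U, w U ≤ C) {g m ℓ : Density P j G} (hg : Measurable g) (hmm : Measurable m) (hℓ : Measurable ℓ)
    {Bg Bm Bℓ : ℝ} (hBg : ∀ U, |g U| ≤ Bg) (hBm : ∀ U, |m U| ≤ Bm) (hBℓ : ∀ U, |ℓ U| ≤ Bℓ) (hmI : FibreIndep s m)
    {V : GaugeField P j G} (hne : fibreIntegral s w V ≠ 0) {p q : ℝ} (hp : |condMean s w ℓ V| ≤ p)
    (hq : ∀ y : s → G, w (updateFinset V s y) ≠ 0 → |g (updateFinset V s y) - m V - ℓ (updateFinset V s y)| ≤ q) :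
    |condMean s w g V - m V| ≤ p + q := by
  haveI := isProbabilityMeasure_condLaw s hC V hne
  have hgm : ∀ U, |g U - m U| ≤ Bg + Bm := fun U => (abs_sub _ _).trans (add_le_add (hBg U) (hBm U))
  have hq' : |condMean s w (fun U => g U - m U - ℓ U) V| ≤ q := by
    rw [condMean, ← Real.norm_eq_abs]
    have h := norm_integral_le_of_norm_le_const (μ := condLaw s w V)
      (f := fun y : s → G => g (updateFinset V s y) - m (updateFinset V s y) - ℓ (updateFinset V s y)) (C := q)
      (ae_condLaw_of_support s hm V fun y hy => by
        rw [Real.norm_eq_abs, hmI V y]; exact hq y hy)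
    rwa [probReal_univ, mul_one] at h
  have e : condMean s w g V - m V = condMean s w (fun U => g U - m U - ℓ U) V + condMean s w ℓ V := by
    rw [condMean_sub s hC (hg.sub hmm) hℓ (g₁ := fun U => g U - m U) hgm hBℓ V,
      condMean_sub s hC hg hmm hBg hBm V, condMean_of_fibreIndep s hC hmI V hne]
    ring
  rw [e]
  exact (abs_add_le _ _).trans ((add_le_add hq' hp).trans (le_of_eq (add_comm q p)))

omit [DecidableEq (PBond P j)] in
/-- **(B2′) THE TWO-LAW GAP WITH THE INSERT SIDE LOCALISED** to the live set of the integrated density: a one-law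
deviation `ε₁` for `old` and a deviation `ε₂` of the insert's conditional mean from the SAME reference at the exteriors
where `old` has mass give `CondMeanGap s ins old g (ε₁ + ε₂)` (triangle inequality; compare
`T4ObservableTelescope.condMeanGap_of_dev`, whose insert-side hypothesis is global). [folklore] -/
theorem condMeanGap_of_dev_at [DecidableEq (PBond P j)] {s : Finset (PBond P j)} {ins old : Density P j G}
    {g m : Density P j G} {ε₁ ε₂ : ℝ} (h₁ : CondMeanDev s old g m ε₁)
    (h₂ : ∀ V, fibreIntegral s old V ≠ 0 → |condMean s ins g V - m V| ≤ ε₂) : CondMeanGap s ins old g (ε₁ + ε₂) := by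
  intro V hne
  have e : condMean s old g V - condMean s ins g V
      = (condMean s old g V - m V) - (condMean s ins g V - m V) := by ring
  rw [e]
  exact (abs_sub _ _).trans (add_le_add (h₁ V hne) (h₂ V hne))

/-- **(B3) THE INCREMENT, END TO END**: under the printed provisos of one term, for a nonnegative bounded measurable weight
`g`, a bounded measurable fibre-independent reference `m`, the linear density of `Φ` as linear part, CONDITIONAL-MEAN
SUPPRESSION data for the OLD TERM'S fibre law (`dom₁, dev₁, lip₁`, cap `d₁`) AND for the INSERT'S (`dom₂, dev₂, lip₂`, cap
`d₂`), both domains covering the exteriors where the old term has mass, and second-order remainder bounds `q₁` / `q₂` on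
the respective supports: `|termDefect s ins old g| ≤ ((p₁ + q₁) + (p₂ + q₂))·∫dV old`, `pᵢ = |t|·(|S|·A·(lipᵢ·dᵢ))` —
`T4ObservableTelescope.abs_termDefect_le_of_condMeanGap` ∘ (B2′) ∘ (B1)/(B2).  Every size is a binder. [folklore] -/
theorem abs_termDefect_le_of_suppression [CompleteSpace E] {s : Finset (PBond P j)} {ins old : Density P j G} {C : ℝ}
    (hP : TermProvisos s ins old C) {g : Density P j G} (hg : Measurable g) (hg0 : ∀ U, 0 ≤ g U) {Bg : ℝ}
    (hgB : ∀ U, g U ≤ Bg) {m : Density P j G} (hmm : Measurable m) {Bm : ℝ} (hBm : ∀ U, |m U| ≤ Bm)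
    (hmI : FibreIndep s m) (t : ℝ) {S : Finset β} {a : β → E} {A : ℝ} (hA : ∀ b ∈ S, ‖a b‖ ≤ A)
    {Φ : GaugeField P j G → β → E} (hΦ : ∀ b ∈ S, StronglyMeasurable fun U => Φ U b) {R : ℝ}
    (hR : ∀ b ∈ S, ∀ U, ‖Φ U b‖ ≤ R) {dom₁ dom₂ : Set (GaugeField P j G)} {dev₁ dev₂ : GaugeField P j G → ℝ}
    {lip₁ lip₂ d₁ d₂ q₁ q₂ : ℝ} (hsup₁ : CondMeanSuppression dom₁ (condMeanField s old Φ) S dev₁ lip₁)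
    (hsup₂ : CondMeanSuppression dom₂ (condMeanField s ins Φ) S dev₂ lip₂)
    (hdom₁ : ∀ V, fibreIntegral s old V ≠ 0 → V ∈ dom₁) (hdom₂ : ∀ V, fibreIntegral s old V ≠ 0 → V ∈ dom₂)
    (hdev₁ : ∀ V ∈ dom₁, dev₁ V ≤ d₁) (hdev₂ : ∀ V ∈ dom₂, dev₂ V ≤ d₂) (hlip₁ : 0 ≤ lip₁) (hlip₂ : 0 ≤ lip₂)
    (hq₁ : ∀ (V : GaugeField P j G) (y : s → G), old (updateFinset V s y) ≠ 0 →
      |g (updateFinset V s y) - m V - linDensity t S a Φ (updateFinset V s y)| ≤ q₁)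
    (hq₂ : ∀ (V : GaugeField P j G) (y : s → G), fibreIntegral s old V ≠ 0 → ins (updateFinset V s y) ≠ 0 →
      |g (updateFinset V s y) - m V - linDensity t S a Φ (updateFinset V s y)| ≤ q₂) :
    |termDefect s ins old g|
      ≤ ((|t| * ((S.card : ℝ) * A * (lip₁ * d₁)) + q₁) + (|t| * ((S.card : ℝ) * A * (lip₂ * d₂)) + q₂))
        * ∫ V, old V ∂fieldMeasure P j G := by
  have hBg : ∀ U, |g U| ≤ Bg := fun U => by rw [abs_of_nonneg (hg0 U)]; exact hgB U
  refine abs_termDefect_le_of_condMeanGap hP hg hg0 hgB (condMeanGap_of_dev_at (m := m) ?_ ?_)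
  · exact condMeanDev_of_suppression s hP.old_meas hP.old_le hg hmm hBg hBm hmI t hA hΦ hR hsup₁ hdom₁ hdev₁ hlip₁ hq₁
  · intro V hne
    refine abs_condMean_sub_le_of_channels_at s hP.ins_meas hP.ins_le hg hmm (measurable_linDensity t a hΦ) hBg hBm
      (abs_linDensity_le hA hR) hmI (hP.den_ne V) ?_ (fun y hy => hq₂ V y hne hy)
    refine (abs_condMean_linDensity_le s hP.ins_le t hA hΦ hR hsup₂ (hdom₂ V hne)).trans ?_
    exact mul_le_mul_of_nonneg_left
      (mul_le_mul_of_nonneg_left (mul_le_mul_of_nonneg_left (hdev₂ V (hdom₂ V hne)) hlip₂)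
        (card_mul_nonneg_of_amplitude hA)) (abs_nonneg t)

/-! ## §4  Instances BY NAME from the pv16 suppliers (tilt modulus, raw and relative readings) -/

omit [GaugeGroup G] [MeasurableSpace G] [HaarData G] [DecidableEq (PBond P j)] [InnerProductSpace ℝ E] in
/-- An oscillation bound around bond centres gives a UNIFORM norm bound on `S`: `‖B y b‖ ≤ (Σ_{b′∈S}‖c b′‖) + M`.
[folklore] -/
theorem norm_le_of_osc {s : Finset (PBond P j)} {B : (s → G) → β → E} {S : Finset β} {c : β → E} {M : ℝ}
    (hM : ∀ b ∈ S, ∀ y, ‖B y b - c b‖ ≤ M) : ∀ b ∈ S, ∀ y, ‖B y b‖ ≤ (∑ b' ∈ S, ‖c b'‖) + M := by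
  intro b hb y
  calc ‖B y b‖ = ‖(B y b - c b) + c b‖ := by rw [sub_add_cancel]
    _ ≤ ‖B y b - c b‖ + ‖c b‖ := norm_add_le _ _
    _ ≤ M + ∑ b' ∈ S, ‖c b'‖ :=
        add_le_add (hM b hb y) (Finset.single_le_sum (f := fun b' => ‖c b'‖) (fun _ _ => norm_nonneg _) hb)
    _ = (∑ b' ∈ S, ‖c b'‖) + M := add_comm _ _

omit [MeasurableSpace G] [HaarData G] [DecidableEq (PBond P j)] [InnerProductSpace ℝ E] in
/-- … hence `0 ≤ M` as soon as `S` is nonempty. [folklore] -/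
theorem osc_nonneg {s : Finset (PBond P j)} {B : (s → G) → β → E} {S : Finset β} {c : β → E} {M : ℝ}
    (hM : ∀ b ∈ S, ∀ y, ‖B y b - c b‖ ≤ M) {b : β} (hb : b ∈ S) : 0 ≤ M :=
  (norm_nonneg _).trans (hM b hb fun _ => 1)

/-! ### The raw fibre reading (`T4TiltModulus.condMeanSuppression_of_tilt`) -/

omit [MeasurableSpace G] [HaarData G] [DecidableEq (PBond P j)] [NormedAddCommGroup E] [InnerProductSpace ℝ E] in
/-- THE RAW FIBRE READING of bond inserts `B : (s → G) → β → E` as a bond-insert field: `U ↦ B(U⌈_s)`. [folklore] -/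
def fibreReading (s : Finset (PBond P j)) (B : (s → G) → β → E) : GaugeField P j G → β → E := fun U => B (onFibre s U)

omit [GaugeGroup G] [MeasurableSpace G] [HaarData G] [NormedAddCommGroup E] [InnerProductSpace ℝ E] in
/-- On the fibre through `V` the raw reading is the insert: `fibreReading s B (V←y) = B y`. [folklore] -/
@[simp] theorem fibreReading_updateFinset (s : Finset (PBond P j)) (B : (s → G) → β → E) (V : GaugeField P j G)
    (y : s → G) : fibreReading s B (updateFinset V s y) = B y := by
  simp only [fibreReading, onFibre_updateFinset]

/-- The conditional mean field of the raw reading IS the exterior-indexed mean field of `T4TiltModulus` §3. [folklore] -/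
theorem condMeanField_fibreReading (s : Finset (PBond P j)) (w : Density P j G) (B : (s → G) → β → E)
    (V : GaugeField P j G) : condMeanField s w (fibreReading s B) V = fun b => ∫ y, B y b ∂condLaw s w V := by
  funext b
  simp only [condMeanField, fibreReading_updateFinset]

omit [GaugeGroup G] [HaarData G] [DecidableEq (PBond P j)] [InnerProductSpace ℝ E] in
/-- Bondwise strong measurability of the raw reading from that of the insert. [folklore] -/
theorem stronglyMeasurable_fibreReading (s : Finset (PBond P j)) {B : (s → G) → β → E} {b : β}
    (hB : StronglyMeasurable fun y => B y b) : StronglyMeasurable fun U => fibreReading s B U b :=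
  hB.comp_measurable (measurable_onFibre s)

/-- **THE FIRST-ORDER CHANNEL FROM THE TILT MODULUS (raw reading), BY NAME.**  Tilt data of
`T4TiltModulus.condMeanSuppression_of_tilt` (measurable `0 ≤ old ≤ C`, the printed proviso at the reference exterior `u₀`,
bond inserts strongly measurable with oscillation `≤ M` around centres `c`, `MeanVanishes` at `u₀`) and a cover of the old
term's live exteriors by the tilt domain `tiltDom s old u₀ κ ε ε₀` give the channel with
`p = |t|·(|S|·A·(2e^{2ε₀}M·ε₀))` — the deviation cap `ε ≤ ε₀` being part of the tilt domain. [folklore] -/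
theorem condMean_channel_of_tilt [CompleteSpace E] (s : Finset (PBond P j)) {old : Density P j G} (hm : Measurable old)
    (h0 : ∀ U, 0 ≤ old U) {C : ℝ} (hC : ∀ U, old U ≤ C) {u₀ : GaugeField P j G} (hne : fibreIntegral s old u₀ ≠ 0)
    {κ ε : GaugeField P j G → ℝ} {ε₀ : ℝ} {B : (s → G) → β → E} {S : Finset β}
    (hB : ∀ b ∈ S, StronglyMeasurable fun y => B y b) {c : β → E} {M : ℝ} (hM : ∀ b ∈ S, ∀ y, ‖B y b - c b‖ ≤ M)
    (hflat : MeanVanishes S fun b => ∫ y, B y b ∂condLaw s old u₀)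
    (hdom : ∀ V, fibreIntegral s old V ≠ 0 → V ∈ tiltDom s old u₀ κ ε ε₀) (t : ℝ) {a : β → E} {A : ℝ}
    (hA : ∀ b ∈ S, ‖a b‖ ≤ A) :
    ∀ V, fibreIntegral s old V ≠ 0 →
      |condMean s old (linDensity t S a (fibreReading s B)) V|
        ≤ |t| * ((S.card : ℝ) * A * (2 * Real.exp (2 * ε₀) * M * ε₀)) := by
  rcases S.eq_empty_or_nonempty with hS | ⟨b₀, hb₀⟩
  · intro V _
    subst hS
    simp [condMean, linDensity_apply, linTerm]
  have hsup : CondMeanSuppression (tiltDom s old u₀ κ ε ε₀) (condMeanField s old (fibreReading s B)) S ε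
      (2 * Real.exp (2 * ε₀) * M) := by
    intro u hu b hb
    rw [condMeanField_fibreReading]
    exact condMeanSuppression_of_tilt s hm h0 hC hne (fun b hb => (hB b hb).aestronglyMeasurable) hM hflat u hu b hb
  exact condMean_channel_of_suppression s hC t hA (fun b hb => stronglyMeasurable_fibreReading s (hB b hb))
    (fun b hb U => norm_le_of_osc hM b hb _) hsup hdom (fun V hV => hV.2.2)
    (mul_nonneg (mul_nonneg zero_le_two (Real.exp_pos _).le) (osc_nonneg hM hb₀))

/-! ### The relative reading (`T4TiltModulusRelative.condMeanSuppression_of_relTilt`) -/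

omit [MeasurableSpace G] [HaarData G] [DecidableEq (PBond P j)] [NormedAddCommGroup E] [InnerProductSpace ℝ E] in
/-- THE RELATIVE READING of bond inserts through the background `vΛ`: `U ↦ B(U⌈_s·(vΛ U)⌈_s⁻¹)` = the relative insert
`relInsert s vΛ B U` evaluated at the raw fibre coordinates of `U` (the shape of an observable of «V′ = V(V^{(k)})⁻¹»).
[folklore] -/
def relReading (s : Finset (PBond P j)) (vΛ : GaugeField P j G → GaugeField P j G) (B : (s → G) → β → E) :
    GaugeField P j G → β → E :=
  fun U => relInsert s vΛ B U (onFibre s U)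

omit [MeasurableSpace G] [HaarData G] [NormedAddCommGroup E] [InnerProductSpace ℝ E] in
/-- Under `FieldIndep s vΛ`, on the fibre through `V` the relative reading is the relative insert at `V`:
`relReading s vΛ B (V←y) = relInsert s vΛ B V y`. [folklore] -/
theorem relReading_updateFinset (s : Finset (PBond P j)) {vΛ : GaugeField P j G → GaugeField P j G}
    (hv : FieldIndep s vΛ) (B : (s → G) → β → E) (V : GaugeField P j G) (y : s → G) :
    relReading s vΛ B (updateFinset V s y) = relInsert s vΛ B V y := by
  simp only [relReading, relInsert_apply, onFibre_updateFinset, hv V y]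

/-- … so its conditional mean field is the mean field of the relative inserts of `T4TiltModulusRelative` §3. [folklore] -/
theorem condMeanField_relReading (s : Finset (PBond P j)) {vΛ : GaugeField P j G → GaugeField P j G}
    (hv : FieldIndep s vΛ) (w : Density P j G) (B : (s → G) → β → E) (V : GaugeField P j G) :
    condMeanField s w (relReading s vΛ B) V = fun b => ∫ y, relInsert s vΛ B V y b ∂condLaw s w V := by
  funext b
  simp only [condMeanField, relReading_updateFinset s hv]

omit [HaarData G] [DecidableEq (PBond P j)] [InnerProductSpace ℝ E] in
/-- Bondwise strong measurability of the relative reading from that of the insert, for a measurable background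
(measurable group operations). [folklore] -/
theorem stronglyMeasurable_relReading [MeasurableMul₂ G] [MeasurableInv G] (s : Finset (PBond P j))
    {vΛ : GaugeField P j G → GaugeField P j G} (hvm : Measurable vΛ) {B : (s → G) → β → E} {b : β}
    (hB : StronglyMeasurable fun y => B y b) : StronglyMeasurable fun U => relReading s vΛ B U b :=
  hB.comp_measurable (measurable_pi_lambda _ fun b' =>
    (measurable_pi_apply (b' : PBond P j)).mul ((measurable_pi_apply (b' : PBond P j)).comp hvm).inv)

/-- **THE FIRST-ORDER CHANNEL FROM THE RELATIVE TILT MODULUS, BY NAME.**  Data of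
`T4TiltModulusRelative.condMeanSuppression_of_relTilt` (background `vΛ` with `FieldIndep s vΛ`, RAW law `old`
measurable with `0 ≤ old ≤ C` and the printed proviso at `u₀`, inserts a.e.-strongly measurable on the fibre with
oscillation `≤ M` around centres, `MeanVanishes` of the relative inserts at `u₀`), bondwise strong measurability of the
relative reading (binder; `stronglyMeasurable_relReading` supplies it for a measurable background), and a cover of the old
term's live exteriors by the RELATIVE tilt domain `tiltDom s (relDensity s vΛ old) u₀ κ ε ε₀`: the channel with the same
`p = |t|·(|S|·A·(2e^{2ε₀}M·ε₀))`. [folklore] -/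
theorem condMean_channel_of_relTilt [CompleteSpace E] [MeasurableMul G] (s : Finset (PBond P j))
    {vΛ : GaugeField P j G → GaugeField P j G} (hv : FieldIndep s vΛ) {old : Density P j G} (hm : Measurable old)
    (h0 : ∀ U, 0 ≤ old U) {C : ℝ} (hC : ∀ U, old U ≤ C) {u₀ : GaugeField P j G} (hne : fibreIntegral s old u₀ ≠ 0)
    {κ ε : GaugeField P j G → ℝ} {ε₀ : ℝ} {B : (s → G) → β → E} {S : Finset β}
    (hB : ∀ b ∈ S, AEStronglyMeasurable (fun y => B y b) (fibreBase s))
    (hΦ : ∀ b ∈ S, StronglyMeasurable fun U => relReading s vΛ B U b) {c : β → E} {M : ℝ}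
    (hM : ∀ b ∈ S, ∀ y, ‖B y b - c b‖ ≤ M)
    (hflat : MeanVanishes S fun b => ∫ y, relInsert s vΛ B u₀ y b ∂condLaw s old u₀)
    (hdom : ∀ V, fibreIntegral s old V ≠ 0 → V ∈ tiltDom s (relDensity s vΛ old) u₀ κ ε ε₀) (t : ℝ) {a : β → E}
    {A : ℝ} (hA : ∀ b ∈ S, ‖a b‖ ≤ A) :
    ∀ V, fibreIntegral s old V ≠ 0 →
      |condMean s old (linDensity t S a (relReading s vΛ B)) V|
        ≤ |t| * ((S.card : ℝ) * A * (2 * Real.exp (2 * ε₀) * M * ε₀)) := by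
  rcases S.eq_empty_or_nonempty with hS | ⟨b₀, hb₀⟩
  · intro V _
    subst hS
    simp [condMean, linDensity_apply, linTerm]
  have hsup : CondMeanSuppression (tiltDom s (relDensity s vΛ old) u₀ κ ε ε₀) (condMeanField s old (relReading s vΛ B))
      S ε (2 * Real.exp (2 * ε₀) * M) := by
    intro u hu b hb
    rw [condMeanField_relReading s hv]
    exact condMeanSuppression_of_relTilt s hv hm h0 hC hne hB hM hflat u hu b hb
  exact condMean_channel_of_suppression s hC t hA hΦ (fun b hb U => norm_le_of_osc hM b hb _) hsup hdom
    (fun V hV => hV.2.2) (mul_nonneg (mul_nonneg zero_le_two (Real.exp_pos _).le) (osc_nonneg hM hb₀))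

end Fibre

end Literature.MathematicalPhysics.QuantumFieldTheory.Balaban1983to89.T4CondMeanChannel
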